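import Literature.LinearAlgebra.Matrix.PerronSymmetric

/-!
# Nonnegative symmetric matrices with positive diagonal: `-λ_max` is not an eigenvalue, and the
# transfer-matrix trace ratios `Tr(K Aˢ)/Tr(A^{s+r})` converge

Topic `LinearAlgebra/Matrix`, namespace `Literature.LinearAlgebra.Matrix`; a complement to
`PerronSymmetric.lean` (Ding–Zhou 2009, §2.1) that needs NEITHER strict positivity NOR
irreducibility. For a real symmetric matrix `A` with entries `≥ 0` and diagonal entries `≥ δ`:

* `two_mul_sub_topEigenvalue_le_eigenvalues`: **every eigenvalue satisfies
  `λ ≥ 2δ - λ_max`**. Proof (Ding–Zhou 2009, §2.1, proof of Thm 2.1, the step `|xᵀNx| ≤ |x|ᵀN|x|`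
  for `N ≥ 0`, applied to `N = A - δI`): for a unit eigenvector `b` of `λ`,
  `λ = bᵀNb + δ ≥ -|b|ᵀN|b| + δ = -(|b|ᵀA|b| - δ) + δ ≥ 2δ - λ_max` by the Rayleigh bound.
  Hence for `δ > 0` the only eigenvalue of modulus `λ_max` is `λ_max` itself
  (`eigenvalues_eq_topEigenvalue_of_abs_eq`, `abs_div_topEigenvalue_lt_one`) — the conclusion one
  usually draws from aperiodicity in the Perron–Frobenius theorem, here without irreducibility
  (cf. Seneta, *Non-negative Matrices and Markov Chains*, Thm 1.1 and Ex. 1.10: a primitive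
  matrix has no other eigenvalue on the spectral circle; positive diagonal gives aperiodicity).
* `tendsto_trace_mul_pow_div_trace_pow_add`: consequently, for every matrix `K` and every
  `r ∈ ℕ`, **`Tr(K Aˢ) / Tr(A^{s+r}) → (∑_{λᵢ = λ_max} (UᵀKU)ᵢᵢ) / (d · λ_max^r)`** as `s → ∞`,
  where `d ≥ 1` is the multiplicity of `λ_max` — the `M → ∞` limit of transfer-matrix
  expressions `Tr(𝔬_X t^{M-r}) / Tr(t^M)` for lattice models on a cylinder whose transfer matrix
  is symmetric, nonnegative, with positive diagonal (e.g. the six-vertex model at `a = b`,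
  Duminil-Copin–Kozlowski–Lammers–Manolescu 2026, Lemma 22 / eq. (cylop)), with no
  non-degeneracy assumption on the top eigenvalue.

## References

* J. Ding, A. Zhou, *Nonnegative Matrices, Positive Operators, and Applications* (2009), §2.1,
  Theorem 2.1 and its proof. [DingZhou2009]
* H. Duminil-Copin, K. K. Kozlowski, P. Lammers, I. Manolescu, arXiv:2603.06268 (2026), Part III
  §1, eq. (cylop) and Lemma 22 (the application). [DKLM2026SixVertexGFF]
-/

noncomputable section

open Matrix Finset Filter Topology

namespace Literature.LinearAlgebra.Matrix

variable {n : Type*} [Fintype n] [DecidableEq n] {A : Matrix n n ℝ}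

/-! ### Quadratic forms of nonnegative matrices -/

omit [DecidableEq n] in
/-- `|xᵀAx| ≤ |x|ᵀA|x|` for an entrywise nonnegative matrix (Ding–Zhou 2009, proof of Thm 2.1).
[cite: DingZhou2009, §2.1, proof of Theorem 2.1] -/
theorem abs_dotProduct_mulVec_le_dotProduct_abs (hA0 : ∀ i j, 0 ≤ A i j) (x : n → ℝ) :
    |x ⬝ᵥ (A *ᵥ x)| ≤ (fun i => |x i|) ⬝ᵥ (A *ᵥ fun i => |x i|) := by
  simp only [dotProduct, mulVec, Finset.mul_sum]
  refine (Finset.abs_sum_le_sum_abs _ _).trans (Finset.sum_le_sum fun i _ => ?_)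
  refine (Finset.abs_sum_le_sum_abs _ _).trans (Finset.sum_le_sum fun j _ => ?_)
  rw [abs_mul, abs_mul, abs_of_nonneg (hA0 i j)]

omit [DecidableEq n] in
/-- `|x|ᵀ|x| = xᵀx`. [folklore] -/
theorem dotProduct_abs_self (x : n → ℝ) : (fun i => |x i|) ⬝ᵥ (fun i => |x i|) = x ⬝ᵥ x := by
  simp only [dotProduct]
  exact Finset.sum_congr rfl fun i _ => abs_mul_abs_self (x i)

/-- The quadratic form of `A - δI`. [folklore] -/
theorem dotProduct_sub_smul_one_mulVec (δ : ℝ) (x : n → ℝ) :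
    x ⬝ᵥ ((A - δ • (1 : Matrix n n ℝ)) *ᵥ x) = x ⬝ᵥ (A *ᵥ x) - δ * (x ⬝ᵥ x) := by
  rw [sub_mulVec, smul_mulVec, one_mulVec, dotProduct_sub, dotProduct_smul, smul_eq_mul]

/-- A diagonal entry is at most the largest eigenvalue (Rayleigh bound at a basis vector).
[folklore] -/
theorem apply_self_le_topEigenvalue [Nonempty n] (hA : A.IsHermitian) (i : n) :
    A i i ≤ topEigenvalue hA := by
  have h := dotProduct_mulVec_le hA (Pi.single i 1)
  have h1 : Pi.single i (1 : ℝ) ⬝ᵥ (A *ᵥ Pi.single i 1) = A i i := by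
    simp [mulVec, dotProduct, Pi.single_apply]
  have h2 : Pi.single i (1 : ℝ) ⬝ᵥ Pi.single i (1 : ℝ) = 1 := by
    simp [dotProduct, Pi.single_apply]
  rw [h1, h2, mul_one] at h
  exact h

/-- If all diagonal entries are `≥ δ > 0` then `λ_max > 0`. [folklore] -/
theorem topEigenvalue_pos_of_diag [Nonempty n] (hA : A.IsHermitian) {δ : ℝ} (hδ : 0 < δ)
    (hdiag : ∀ i, δ ≤ A i i) :
    0 < topEigenvalue hA :=
  hδ.trans_le ((hdiag _).trans (apply_self_le_topEigenvalue hA (Classical.arbitrary n)))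

/-- An eigenvalue is the quadratic form at its unit eigenvector. [folklore] -/
theorem eigenvalues_eq_dotProduct_mulVec (hA : A.IsHermitian) (k : n) :
    hA.eigenvalues k =
      (hA.eigenvectorBasis k).ofLp ⬝ᵥ (A *ᵥ (hA.eigenvectorBasis k).ofLp) := by
  have hbb := eigenvectorBasis_dotProduct hA k k
  rw [if_pos rfl] at hbb
  rw [hA.mulVec_eigenvectorBasis k, dotProduct_smul, hbb, smul_eq_mul, mul_one]

/-- **Every eigenvalue of a symmetric matrix with nonnegative off-diagonal entries and diagonal
entries `≥ δ` is at least `2δ - λ_max`** (via `|bᵀNb| ≤ |b|ᵀN|b|` for `N = A - δI ≥ 0` and the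
Rayleigh bound). [cite: DingZhou2009, §2.1, proof of Theorem 2.1] -/
theorem two_mul_sub_topEigenvalue_le_eigenvalues [Nonempty n] (hA : A.IsHermitian)
    (hA0 : ∀ i j, i ≠ j → 0 ≤ A i j) {δ : ℝ} (hdiag : ∀ i, δ ≤ A i i) (k : n) :
    2 * δ - topEigenvalue hA ≤ hA.eigenvalues k := by
  set b : n → ℝ := (hA.eigenvectorBasis k).ofLp with hb
  set a : n → ℝ := fun i => |b i| with ha
  have hbb : b ⬝ᵥ b = 1 := by
    have h := eigenvectorBasis_dotProduct hA k k
    rwa [if_pos rfl] at h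
  have haa : a ⬝ᵥ a = 1 := by rw [ha, dotProduct_abs_self, hbb]
  have hlam : hA.eigenvalues k = b ⬝ᵥ (A *ᵥ b) := eigenvalues_eq_dotProduct_mulVec hA k
  -- `N = A - δ I` is entrywise nonnegative
  have hN0 : ∀ i j, 0 ≤ (A - δ • (1 : Matrix n n ℝ)) i j := by
    intro i j
    rw [Matrix.sub_apply, Matrix.smul_apply, one_apply, smul_eq_mul]
    by_cases hij : i = j
    · subst hij
      rw [if_pos rfl, mul_one, sub_nonneg]
      exact hdiag i
    · rw [if_neg hij, mul_zero, sub_zero]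
      exact hA0 i j hij
  have h1 := abs_dotProduct_mulVec_le_dotProduct_abs hN0 b
  rw [dotProduct_sub_smul_one_mulVec, dotProduct_sub_smul_one_mulVec, hbb, mul_one] at h1
  have h2 : a ⬝ᵥ (A *ᵥ a) ≤ topEigenvalue hA := by
    have h := dotProduct_mulVec_le hA a
    rwa [haa, mul_one] at h
  have h3 : a ⬝ᵥ a = 1 := haa
  rw [h3, mul_one] at h1
  have h4 := (abs_le.mp h1).1
  rw [hlam]
  linarith

/-- With diagonal entries `≥ δ > 0` and nonnegative entries: **an eigenvalue of modulus `λ_max`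
equals `λ_max`** (`-λ_max` is not an eigenvalue). [cite: DingZhou2009, §2.1, Theorem 2.1] -/
theorem eigenvalues_eq_topEigenvalue_of_abs_eq [Nonempty n] (hA : A.IsHermitian)
    (hA0 : ∀ i j, i ≠ j → 0 ≤ A i j)
    {δ : ℝ} (hδ : 0 < δ) (hdiag : ∀ i, δ ≤ A i i) {k : n}
    (h : |hA.eigenvalues k| = topEigenvalue hA) : hA.eigenvalues k = topEigenvalue hA := by
  rcases abs_eq_abs.mp (h.trans (abs_of_pos (topEigenvalue_pos_of_diag hA hδ hdiag)).symm) with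
    h' | h'
  · exact h'
  · have := two_mul_sub_topEigenvalue_le_eigenvalues hA hA0 hdiag k
    linarith

/-- With diagonal entries `≥ δ > 0` and nonnegative entries, every eigenvalue other than `λ_max`
has `|λ / λ_max| < 1`. [cite: DingZhou2009, §2.1, Theorem 2.1] -/
theorem abs_div_topEigenvalue_lt_one [Nonempty n] (hA : A.IsHermitian)
    (hA0 : ∀ i j, i ≠ j → 0 ≤ A i j)
    {δ : ℝ} (hδ : 0 < δ) (hdiag : ∀ i, δ ≤ A i i) {k : n}
    (hne : hA.eigenvalues k ≠ topEigenvalue hA) :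
    |hA.eigenvalues k / topEigenvalue hA| < 1 := by
  have hL := topEigenvalue_pos_of_diag hA hδ hdiag
  rw [abs_div, abs_of_pos hL, div_lt_one hL]
  refine lt_of_le_of_ne ?_ fun h => hne (eigenvalues_eq_topEigenvalue_of_abs_eq hA hA0 hδ hdiag h)
  rw [abs_le]
  refine ⟨?_, eigenvalues_le_topEigenvalue hA k⟩
  have := two_mul_sub_topEigenvalue_le_eigenvalues hA hA0 hdiag k
  linarith

/-! ### The transfer-matrix limit without non-degeneracy -/

/-- **`Tr(K Aˢ)/Tr(A^{s+r})` converges** as `s → ∞`, for a real symmetric matrix with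
nonnegative entries and positive diagonal, any `K` and any `r`: only the eigenvalues equal to
`λ_max` survive, and the limit is `(∑_{λᵢ = λ_max} (UᵀKU)ᵢᵢ) / (#{i : λᵢ = λ_max} · λ_max^r)`.
This is the `M → ∞` limit of cylinder/torus transfer-matrix expressions (DKLM 2026, eq. (cylop),
Lemma 22) when the transfer matrix is symmetric with positive diagonal.
[cite: DingZhou2009, §2.1, Theorem 2.1 (consequence); DKLM2026SixVertexGFF, Lemma 22] -/
theorem tendsto_trace_mul_pow_div_trace_pow_add [Nonempty n] (hA : A.IsHermitian)
    (hA0 : ∀ i j, i ≠ j → 0 ≤ A i j)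
    {δ : ℝ} (hδ : 0 < δ) (hdiag : ∀ i, δ ≤ A i i) (K : Matrix n n ℝ) (r : ℕ) :
    Tendsto (fun s : ℕ => (K * A ^ s).trace / (A ^ (s + r)).trace) atTop
      (𝓝 ((∑ i ∈ univ.filter (fun i => hA.eigenvalues i = topEigenvalue hA),
          (star (eigU hA) * K * eigU hA) i i) /
        ((univ.filter fun i => hA.eigenvalues i = topEigenvalue hA).card * topEigenvalue hA ^ r))) := by
  set ev : n → ℝ := hA.eigenvalues with hev
  set L : ℝ := topEigenvalue hA with hL
  have hLpos : 0 < L := topEigenvalue_pos_of_diag hA hδ hdiag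
  -- normalised powers converge to the indicator of the top eigenvalues
  have hlim : ∀ i, Tendsto (fun s : ℕ => (ev i / L) ^ s) atTop
      (𝓝 (if ev i = L then 1 else 0)) := by
    intro i
    by_cases h : ev i = L
    · rw [if_pos h, h, div_self hLpos.ne']
      simp
    · rw [if_neg h]
      exact tendsto_pow_atTop_nhds_zero_of_abs_lt_one
        (abs_div_topEigenvalue_lt_one hA hA0 hδ hdiag h)
  set c : n → ℝ := fun i => (star (eigU hA) * K * eigU hA) i i with hc
  have hnumlim : Tendsto (fun s : ℕ => ∑ i, c i * (ev i / L) ^ s) atTop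
      (𝓝 (∑ i, c i * if ev i = L then 1 else 0)) :=
    tendsto_finsetSum _ fun i _ => (hlim i).const_mul (c i)
  have hdenlim : Tendsto (fun s : ℕ => L ^ r * ∑ i, (ev i / L) ^ (s + r)) atTop
      (𝓝 (L ^ r * ∑ i, (if ev i = L then 1 else 0 : ℝ))) :=
    (tendsto_finsetSum _ fun i _ => (hlim i).comp (tendsto_add_atTop_nat r)).const_mul _
  have hnum_eq : (∑ i, c i * if ev i = L then 1 else 0) =
      ∑ i ∈ univ.filter (fun i => ev i = L), c i := by
    rw [Finset.sum_filter]
    exact Finset.sum_congr rfl fun i _ => by split_ifs <;> simp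
  have hden_eq : (L ^ r * ∑ i, (if ev i = L then 1 else 0 : ℝ)) =
      ((univ.filter fun i => ev i = L).card : ℝ) * L ^ r := by
    rw [Finset.sum_boole, mul_comm]
  have hden_ne : ((univ.filter fun i => ev i = L).card : ℝ) * L ^ r ≠ 0 := by
    refine mul_ne_zero ?_ (pow_ne_zero _ hLpos.ne')
    obtain ⟨i₀, hi₀⟩ := exists_eigenvalues_eq_topEigenvalue hA
    have hmem : i₀ ∈ univ.filter fun i => ev i = L := by simp [hi₀, hev, hL]
    exact_mod_cast (Finset.card_pos.mpr ⟨i₀, hmem⟩).ne'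
  rw [hnum_eq] at hnumlim
  rw [hden_eq] at hdenlim
  have hratio := hnumlim.div hdenlim hden_ne
  refine hratio.congr' ?_
  filter_upwards with s
  simp only [Pi.div_apply]
  rw [trace_mul_pow_eq_sum hA K s, trace_pow_eq_sum hA (s + r)]
  have hLs : L ^ s ≠ 0 := pow_ne_zero _ hLpos.ne'
  have e1 : ∑ i, c i * (ev i / L) ^ s = (∑ i, c i * ev i ^ s) / L ^ s := by
    rw [Finset.sum_div]
    exact Finset.sum_congr rfl fun i _ => by rw [div_pow]; ring
  have e2 : L ^ r * ∑ i, (ev i / L) ^ (s + r) = (∑ i, ev i ^ (s + r)) / L ^ s := by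
    rw [Finset.mul_sum, Finset.sum_div]
    refine Finset.sum_congr rfl fun i _ => ?_
    rw [div_pow, pow_add, pow_add]
    field_simp
  rw [e1, e2, div_div_div_cancel_right₀ hLs]

/-- **Existence of the transfer-matrix limit** `lim_{M → ∞} Tr(K A^{M-r})/Tr(A^M)`, in the form
`∃ q, Tr(K Aˢ)/Tr(A^{s+r}) → q`. [cite: DKLM2026SixVertexGFF, Lemma 22] -/
theorem exists_tendsto_trace_mul_pow_div_trace_pow_add [Nonempty n] (hA : A.IsHermitian)
    (hA0 : ∀ i j, i ≠ j → 0 ≤ A i j) {δ : ℝ} (hδ : 0 < δ) (hdiag : ∀ i, δ ≤ A i i)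
    (K : Matrix n n ℝ) (r : ℕ) :
    ∃ q : ℝ, Tendsto (fun s : ℕ => (K * A ^ s).trace / (A ^ (s + r)).trace) atTop (𝓝 q) :=
  ⟨_, tendsto_trace_mul_pow_div_trace_pow_add hA hA0 hδ hdiag K r⟩

end Literature.LinearAlgebra.Matrix

end
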